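import Summits.QuantumFields.YangMills.Theorems.IR.VolumeMonotoneSpectralFloor
import Summits.QuantumFields.YangMills.Theorems.IR.VolumeMonotoneSliceBridge
import Summits.QuantumFields.YangMills.Theorems.IR.SCFloorFacingPlaquetteRep
import Summits.QuantumFields.YangMills.Theorems.IR.StrongCouplingRateColdPressure
import HarnessLib

/-!
# Crux `IR` (stmt-QuantumFields-19354), line `ym-ir7-volume-monotone-gap` (ideator ym-ir-idea-7), input T-GAP-FINITE-sc —
# part 2b: the torus transfer gap is FINITE, uniformly in the volume, on the strong-coupling engine window

Helper module for item `stmt-QuantumFields-19354` (`--supports … --as helper`; closes nothing by itself).  Pooled prover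
ym-ir-line-pool-p3 (g5).  THE CONTENT of the line's registered input `stub_input_traceExcessFloor : TraceExcessFloorSC`
(`Cruxes/IR/Lines/ym_ir7_volume_monotone_gap.lean`, «`e^{−M(m+2)} ≤ traceExcess r.ρ β (2S+1) (m+2)`, volume-uniformly, on compact
strong-coupling windows») on the window where the tree's floor engine decides it:

* `hasSum_ratio_pow_traceExcess` — the trace excess of Lüscher's transfer matrix as the off-top sum `Σ_{i≠i₀} (λᵢ/λ_{i₀})^t` over the
  eigenbasis of `exists_spectralData_wilsonTorusTransferMatrix`;
* `traceExcess_floor_of_facingCov` — **lag-one facing-plaquette covariance floor ∧ two cold trace excesses small ⇒ geometric floor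
  on EVERY trace excess of the same spatial torus**: if `cv ≤ Cov_W(P₀, P₁)` on `(ℤ/N)⁴` (`N ≥ 3`) and `x_t(N) ≤ ε` for `t ≥ N − 1` with
  `8p²ε ≤ cv` (`p = max N_ρ 1`), then `(cv/(2p²))^{m+2} ≤ traceExcess r.ρ β N (m+2)` for all `m` (parts 1b + 2a);
* `traceExcess_floor_strongCoupling` — **T-GAP-FINITE-sc on the engine window**: for every compact simple Lie group `G` and
  `r : LatticeRep G` there are `0 < βF ≤ strongCouplingRadius r.ρ` and `c₁ > 0` such that for every `β₁ ∈ (0, βF]` there is `S₀` with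
  `(c₁ β⁴)^{m+2} ≤ traceExcess r.ρ β (2S+1) (m+2)` for all `β ∈ [β₁, βF]`, `S ≥ S₀`, `m` — i.e. `λ₁/λ₀ ≥ c₁β⁴`: the second transfer
  eigenvalue (lightest «glueball») sits at most `4 log(1/β) + O(1)` below the vacuum, UNIFORMLY IN THE VOLUME (the β-explicit ceiling
  «input (b)» of the line card).  Inputs: the volume-uniform `β⁴` law `SCFloor.facingPlaquetteCorr_floor_latticeRep` (bsf-p1) and the
  rate-tracking cold-pressure bound `coldPressureBound_strongCoupling_log` (pool-p3 g2) for the two thermal corrections.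

The line's input AS TYPED asks for the window `[β₁, strongCouplingRadius r.ρ]`; the engine's `β₀` may be smaller, so this file proves the
window `[β₁, βF]`, `βF = min β₀ r_ρ` — enough for the rung `VolumeMonotoneStrongCouplingWindow`, which carries its own `∃ βD` (part 3).

HONEST FRAMING: a strong-coupling FORMAT fact (finite, volume-uniform lattice glueball mass at small `β`); nothing here bears on weak coupling,
`BalabanLadder.IR`, or the Yang–Mills mass gap (Clay); R4 of the ladder closes only the conditional finite-𝕋⁴ rung `BalabanLadder.UV`.
Refs: K. Osterwalder, E. Seiler, Ann. Phys. 110 (1978) 440, §3; I. Montvay, G. Münster, *Quantum Fields on a Lattice* (1994), §3.4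
(strong-coupling glueball mass `m = −4 ln u + …`).
-/

set_option autoImplicit false

noncomputable section

open MeasureTheory Filter Function Topology
open scoped RealInnerProductSpace
open Literature.MathematicalPhysics.QuantumFieldTheory
open Literature.MathematicalPhysics.QuantumLattice (plaquetteObs)
open Literature.MathematicalPhysics.QuantumFieldTheory.Balaban1983to89.Sufficient (ColdPressureBound ColdTraceBound)
open Literature.MathematicalPhysics.QuantumFieldTheory.Balaban1983to89.Missing (ColdFreeEnergyBound strongCouplingRadius
  strongCouplingRadius_pos coldFreeEnergyBound_of_strongCoupling coldTraceBound_of_coldFreeEnergyBound)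
open Literature.Analysis.OperatorTheory
open Summit.QuantumFields.YangMills.Cruxes.IR.VolumeMonotone.SpectralFloor
open Summit.QuantumFields.YangMills.Cruxes.IR.VolumeMonotone.SliceBridge

namespace Summit.QuantumFields.YangMills.Cruxes.IR.VolumeMonotone

variable {G : Type} [Group G] [TopologicalSpace G] [IsTopologicalGroup G] [CompactSpace G]
  [MeasurableSpace G] [BorelSpace G]

/-! ## §1 The trace excess as an off-top spectral sum -/

/-- Over the eigen-data of `exists_spectralData_wilsonTorusTransferMatrix`: `traceExcess r.ρ β L (m+2) = Σ_{i≠i₀} (λᵢ/λ_{i₀})^{m+2}`. -/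
theorem hasSum_ratio_pow_traceExcess {ι : Type*} [DecidableEq ι] {lam : ι → ℝ} {i₀ : ι} {n : ℕ}
    (ρ : G →* Matrix (Fin n) (Fin n) ℂ) (β : ℝ) (L : ℕ) [NeZero L] (hL0 : 0 < lam i₀)
    (hrad : transferSpectralRadius ρ β L = lam i₀) (m : ℕ)
    (hZ : HasSum (fun i => lam i ^ (m + 2)) (cyclicPartition ρ β L (m + 2))) :
    HasSum (update (fun i => (lam i / lam i₀) ^ (m + 2)) i₀ 0) (traceExcess ρ β L (m + 2)) := by
  have h1 : HasSum (fun i => (lam i / lam i₀) ^ (m + 2)) (cyclicPartition ρ β L (m + 2) / lam i₀ ^ (m + 2)) := by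
    refine (hZ.div_const (lam i₀ ^ (m + 2))).congr_fun fun i => ?_
    rw [div_pow]
  have h2 := h1.update i₀ 0
  rw [div_self hL0.ne', one_pow] at h2
  have hx : traceExcess ρ β L (m + 2) = 0 - 1 + cyclicPartition ρ β L (m + 2) / lam i₀ ^ (m + 2) := by
    unfold traceExcess; rw [hrad]; ring
  rw [hx]
  exact h2

/-! ## §2 Facing-plaquette covariance floor ∧ cold thermal smallness ⇒ geometric floor on every trace excess -/

/-- **Core step on one torus.**  For `r : LatticeRep G`, `β ≥ 0`, the torus `(ℤ/N)⁴` with `N ≥ 3`, `p = max N_r 1`: if the facing-plaquette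
covariance of the Wilson state is `≥ cv`, the trace excesses `x_{m+2}(N)` with `m + 3 ≥ N` are `≤ ε`, and `8p²ε ≤ cv`, then
`(cv/(2p²))^{m+2} ≤ traceExcess r.ρ β N (m+2)` for every `m`. -/
theorem traceExcess_floor_of_facingCov (r : LatticeRep G) {β : ℝ} (hβ : 0 ≤ β) (N : ℕ) [NeZero N] (hN : 3 ≤ N)
    {cv ε : ℝ}
    (hcov : cv ≤ (∫ U, (r.ρ (plaquetteHolonomy U 0 1 2)).trace.re *
        (r.ρ (plaquetteHolonomy U ((0 : Site 4 N).shift 0) 1 2)).trace.re ∂(wilsonMeasure (d := 4) (L := N) r.ρ β)) -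
      (∫ U, (r.ρ (plaquetteHolonomy U 0 1 2)).trace.re ∂(wilsonMeasure (d := 4) (L := N) r.ρ β)) *
        ∫ U, (r.ρ (plaquetteHolonomy U ((0 : Site 4 N).shift 0) 1 2)).trace.re ∂(wilsonMeasure (d := 4) (L := N) r.ρ β))
    (hx : ∀ m : ℕ, N ≤ m + 3 → traceExcess r.ρ β N (m + 2) ≤ ε)
    (hε : 8 * (max (r.N : ℝ) 1) ^ 2 * ε ≤ cv) :
    ∀ m : ℕ, (cv / (2 * (max (r.N : ℝ) 1) ^ 2)) ^ (m + 2) ≤ traceExcess r.ρ β N (m + 2) := by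
  classical
  haveI : SecondCountableTopology G :=
    (r.continuous.isClosedEmbedding r.injective).isEmbedding.secondCountableTopology
  haveI : IsProbabilityMeasure (haarProbability G) :=
    Literature.RepresentationTheory.CompactGroups.CompactGroup.isProbabilityMeasure_haarMeasure_top
  -- write `N = M + 1 + 2`
  obtain ⟨M, rfl⟩ : ∃ M, N = M + 1 + 2 := ⟨N - 3, by omega⟩
  intro m
  set p : ℝ := max (r.N : ℝ) 1 with hpdef
  have hp : 0 < p := lt_of_lt_of_le one_pos (le_max_right _ _)
  -- spectral data of the transfer matrix of the spatial torus `(M+3)³`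
  obtain ⟨s, _, b, lam, i₀, hb, hle, hL0, -, -, hrad, hZ⟩ :=
    exists_spectralData_wilsonTorusTransferMatrix (M + 1 + 2) r.continuous r.mem_unitary hβ
  set μ : Measure (GaugeConfig 3 (M + 1 + 2) G) := Measure.pi fun _ : Edge 3 (M + 1 + 2) => haarProbability G with hμ
  haveI : IsProbabilityMeasure μ := by rw [hμ]; infer_instance
  have hK := stronglyMeasurable_uncurry_wilsonSliceKernel (L := M + 1 + 2) r.ρ r.continuous β
  obtain ⟨C, hC⟩ := exists_norm_wilsonSliceKernel_le (L := M + 1 + 2) r.ρ r.continuous β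
  have hsymm := wilsonSliceKernel_symm (L := M + 1 + 2) r.ρ r.mem_unitary β
  have hA := wilsonTorusTransferMatrix_ae_eq β (M + 1 + 2) r.continuous
  have hsa : IsSelfAdjoint (wilsonTorusTransferMatrix r.ρ β (M + 1 + 2)) := isSelfAdjoint_kernelOp hK hC hsymm hA
  have hlam0 : ∀ i, 0 ≤ lam i := fun i => (hle i).1
  have hle' : ∀ i, lam i ≤ lam i₀ := fun i => (hle i).2
  -- the spatial plaquette as a one-site weight, `|f| ≤ p`
  set f : GaugeConfig 3 (M + 1 + 2) G → ℝ := fun V => (r.ρ (plaquetteHolonomy V 0 0 1)).trace.re with hf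
  have hfm : Measurable f := (continuous_trace_re r.ρ r.continuous).measurable.comp (measurable_plaquetteHolonomy 0 0 1)
  have hfp : ∀ V, ‖f V‖ ≤ p := fun V => by
    rw [Real.norm_eq_abs]
    have h := Literature.RepresentationTheory.CompactGroups.CompactGroup.abs_re_trace_le_card r.ρ r.continuous
      (plaquetteHolonomy V 0 0 1)
    rw [Fintype.card_fin] at h
    exact h.trans (le_max_left _ _)
  obtain ⟨ψ, hψ⟩ := exists_Lp_mul (μ := μ) hfm hfp (b i₀)
  -- the two partition functions and the two thermal excesses
  have hZt : HasSum (fun i => lam i ^ (M + 3)) (cyclicPartition r.ρ β (M + 1 + 2) (M + 1 + 2)) :=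
    (hZ (M + 1)).congr_fun fun i => by rw [show M + 3 = M + 1 + 2 by ring]
  have hZt' : HasSum (fun i => lam i ^ (M + 2)) (cyclicPartition r.ρ β (M + 1 + 2) (M + 2)) := hZ M
  have hxt : cyclicPartition r.ρ β (M + 1 + 2) (M + 1 + 2) / lam i₀ ^ (M + 3) - 1 =
      traceExcess r.ρ β (M + 1 + 2) (M + 1 + 2) := by
    unfold traceExcess; rw [hrad]
  have hxt' : cyclicPartition r.ρ β (M + 1 + 2) (M + 2) / lam i₀ ^ (M + 2) - 1 = traceExcess r.ρ β (M + 1 + 2) (M + 2) := by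
    unfold traceExcess; rw [hrad]
  -- S2: the torus covariance controls the vacuum covariance
  have hS2 := torusCov_le_vacuumCov (μ := μ) (i₀ := i₀) hK hC hsymm hA hb hlam0 hle' hL0 hfm hp hfp hψ M hZt hZt'
  rw [hxt, hxt'] at hS2
  -- the bridge: the Wilson covariance IS the cyclic one (`ZMod (M+3) = Fin (M+3)` definitionally)
  have hbridge := facingCov_eq_cyclic r hβ (M + 1 + 2)
  have hcyc : (∫ U, (r.ρ (plaquetteHolonomy U 0 1 2)).trace.re *
        (r.ρ (plaquetteHolonomy U ((0 : Site 4 (M + 1 + 2)).shift 0) 1 2)).trace.re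
          ∂(wilsonMeasure (d := 4) (L := M + 1 + 2) r.ρ β)) -
      (∫ U, (r.ρ (plaquetteHolonomy U 0 1 2)).trace.re ∂(wilsonMeasure (d := 4) (L := M + 1 + 2) r.ρ β)) *
        ∫ U, (r.ρ (plaquetteHolonomy U ((0 : Site 4 (M + 1 + 2)).shift 0) 1 2)).trace.re
          ∂(wilsonMeasure (d := 4) (L := M + 1 + 2) r.ρ β) =
      (∫ W : Fin (M + 1 + 2) → GaugeConfig 3 (M + 1 + 2) G, (∏ t, wilsonSliceKernel r.ρ β (W t) (W (t + 1))) *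
          (f (W 0) * f (W 1)) ∂(Measure.pi fun _ => μ)) / cyclicPartition r.ρ β (M + 1 + 2) (M + 1 + 2) -
        ((∫ W : Fin (M + 1 + 2) → GaugeConfig 3 (M + 1 + 2) G, (∏ t, wilsonSliceKernel r.ρ β (W t) (W (t + 1))) * f (W 0)
          ∂(Measure.pi fun _ => μ)) / cyclicPartition r.ρ β (M + 1 + 2) (M + 1 + 2)) ^ 2 := hbridge
  -- the thermal smallness
  have hx1 : traceExcess r.ρ β (M + 1 + 2) (M + 1 + 2) ≤ ε := hx (M + 1) (by omega)
  have hx2 : traceExcess r.ρ β (M + 1 + 2) (M + 2) ≤ ε := hx M (by omega)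
  have hV : cv / 2 ≤ ⟪ψ, wilsonTorusTransferMatrix r.ρ β (M + 1 + 2) ψ⟫ / lam i₀ - ⟪b i₀, ψ⟫ ^ 2 := by
    have hp2 : 0 ≤ p ^ 2 := sq_nonneg _
    rw [hcyc] at hcov
    nlinarith [mul_le_mul_of_nonneg_left hx1 hp2, mul_le_mul_of_nonneg_left hx2 hp2]
  -- S1: the vacuum floor bounds every trace excess
  have hxs := hasSum_ratio_pow_traceExcess r.ρ β (M + 1 + 2) hL0 hrad m (hZ m)
  have hS1 := pow_vacuumCov_le_offTop (μ := μ) hsa hb hlam0 hL0 hp hfp hψ (s := m + 2) (by omega) hxs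
  have hcv0 : 0 ≤ cv := by
    have : 0 ≤ 8 * p ^ 2 * ε := by
      have hε0 : 0 ≤ ε := le_trans ?_ hx1
      · positivity
      · -- a trace excess is non-negative
        exact nonneg_of_hasSum_update (i₀ := i₀) (fun k => pow_nonneg (div_nonneg (hlam0 k) hL0.le) _)
          (hasSum_ratio_pow_traceExcess r.ρ β (M + 1 + 2) hL0 hrad (M + 1) (hZ (M + 1)))
    linarith
  calc (cv / (2 * p ^ 2)) ^ (m + 2)
        ≤ ((⟪ψ, wilsonTorusTransferMatrix r.ρ β (M + 1 + 2) ψ⟫ / lam i₀ - ⟪b i₀, ψ⟫ ^ 2) / p ^ 2) ^ (m + 2) := by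
        refine pow_le_pow_left₀ (div_nonneg hcv0 (by positivity)) ?_ _
        have e : cv / (2 * p ^ 2) = (cv / 2) / p ^ 2 := by field_simp
        rw [e]
        exact div_le_div_of_nonneg_right hV (by positivity)
    _ ≤ traceExcess r.ρ β (M + 1 + 2) (m + 2) := hS1

/-! ## §3 T-GAP-FINITE-sc on the engine window (assembly) -/

/-- **The torus transfer gap is finite, uniformly in the volume, on the strong-coupling engine window** (the content of the line's
input `TraceExcessFloorSC` where the tree's floor engine decides it).  For every compact simple Lie group `G` and `r : LatticeRep G`
there are `0 < βF ≤ strongCouplingRadius r.ρ` and `c₁ > 0` such that for every `β₁ ∈ (0, βF]` there is `S₀` with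
`(c₁ β⁴)^{m+2} ≤ traceExcess r.ρ β (2S+1) (m+2)` for all `β ∈ [β₁, βF]`, `S ≥ S₀` and `m` — `λ₁/λ₀ ≥ c₁ β⁴` for Lüscher's transfer
matrix of every large spatial torus. -/
theorem traceExcess_floor_strongCoupling :
    ∀ (G : Type) [Group G] [TopologicalSpace G] [IsTopologicalGroup G] [CompactSpace G],
      IsCompactSimpleLieGroup G →
      letI : MeasurableSpace G := borel G; haveI : BorelSpace G := ⟨rfl⟩;
      ∀ (r : LatticeRep G), ∃ βF c₁ : ℝ, 0 < βF ∧ βF ≤ strongCouplingRadius r.ρ ∧ 0 < c₁ ∧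
        ∀ β₁ : ℝ, 0 < β₁ → β₁ ≤ βF → ∃ S₀ : ℕ, ∀ β : ℝ, β₁ ≤ β → β ≤ βF → ∀ S : ℕ, S₀ ≤ S → ∀ m : ℕ,
          (c₁ * β ^ 4) ^ (m + 2) ≤ traceExcess r.ρ β (2 * S + 1) (m + 2) := by
  intro G _ _ _ _ hG
  letI : MeasurableSpace G := borel G
  haveI : BorelSpace G := ⟨rfl⟩
  intro r
  haveI : SecondCountableTopology G :=
    (r.continuous.isClosedEmbedding r.injective).isEmbedding.secondCountableTopology
  obtain ⟨β₀, c, C, hβ₀, hc, -, hfloor⟩ := SCFloor.facingPlaquetteCorr_floor_latticeRep G hG r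
  set p : ℝ := max (r.N : ℝ) 1 with hpdef
  have hp : 0 < p := lt_of_lt_of_le one_pos (le_max_right _ _)
  -- the universal strong-coupling constant of the volume-uniform rate-`1/8` cold trace bound
  set Kst : ℝ := 48 * Real.exp 1 with hKst
  set A : ℝ := 3072 * Kst / (1 / 4 : ℝ) ^ 3 * Real.exp (3072 * Kst / (1 / 4 : ℝ) ^ 3) with hAdef
  have hK0 : 0 ≤ Kst := by positivity
  have hA0 : 0 ≤ A := by positivity
  refine ⟨min β₀ (strongCouplingRadius r.ρ), c / (2 * p ^ 2), lt_min hβ₀ (strongCouplingRadius_pos r.ρ), min_le_right _ _,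
    by positivity, fun β₁ hβ₁ hβ₁F => ?_⟩
  -- the thermal threshold `ε = c β₁⁴ / (8 p²)` and the volume floor `S₀`
  set ε : ℝ := c * β₁ ^ 4 / (8 * p ^ 2) with hε
  have hε0 : 0 < ε := by positivity
  obtain ⟨S₀, hS₀⟩ : ∃ S₀ : ℕ, 1 ≤ S₀ ∧ ∀ S : ℕ, S₀ ≤ S → A * Real.exp (-((S : ℝ) / 4)) ≤ ε := by
    refine ⟨⌈4 * Real.log (A / ε)⌉₊ + 1, by omega, fun S hS => ?_⟩
    have hS' : 4 * Real.log (A / ε) ≤ (S : ℝ) := by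
      have h1 : 4 * Real.log (A / ε) ≤ ((⌈4 * Real.log (A / ε)⌉₊ : ℕ) : ℝ) := Nat.le_ceil _
      have h2 : ((⌈4 * Real.log (A / ε)⌉₊ + 1 : ℕ) : ℝ) ≤ (S : ℝ) := by exact_mod_cast hS
      push_cast at h2
      linarith
    rcases eq_or_lt_of_le hA0 with hA | hA
    · rw [← hA, zero_mul]; exact hε0.le
    · have h3 : Real.log (A / ε) ≤ (S : ℝ) / 4 := by linarith
      have h4 : A / ε ≤ Real.exp ((S : ℝ) / 4) := by
        rw [← Real.log_le_iff_le_exp (div_pos hA hε0)]; exact h3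
      rw [div_le_iff₀ hε0] at h4
      have h6 : Real.exp ((S : ℝ) / 4) * Real.exp (-((S : ℝ) / 4)) = 1 := by
        rw [← Real.exp_add, add_neg_cancel, Real.exp_zero]
      calc A * Real.exp (-((S : ℝ) / 4)) ≤ (Real.exp ((S : ℝ) / 4) * ε) * Real.exp (-((S : ℝ) / 4)) :=
            mul_le_mul_of_nonneg_right h4 (Real.exp_nonneg _)
        _ = ε := by rw [mul_assoc, mul_comm ε, ← mul_assoc, h6, one_mul]
  refine ⟨S₀, fun β hβ1 hβF S hS m => ?_⟩
  have hβ0 : 0 ≤ β := le_trans hβ₁.le hβ1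
  have hβpos : 0 < β := lt_of_lt_of_le hβ₁ hβ1
  have hββ₀ : β ≤ β₀ := hβF.trans (min_le_left _ _)
  have hβD : β ≤ strongCouplingRadius r.ρ := hβF.trans (min_le_right _ _)
  have hS1 : 1 ≤ S := hS₀.1.trans hS
  -- the floor on the facing-plaquette covariance of the torus `(2S+1)⁴`
  have hcovL := (hfloor (2 * S + 1) (by omega) β hβpos hββ₀).1
  rw [SCFloor.latticeConnectedCorr_plaquette_one r.ρ (2 * S + 1) β] at hcovL
  -- the thermal smallness: `x_{m+2}(2S+1) ≤ A e^{−(m+2)/8} ≤ A e^{−S/4} ≤ ε` for `m + 2 ≥ 2S`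
  have hT : ColdTraceBound r.ρ β S (1 / 4 / 2) A := by
    have hFE : ColdFreeEnergyBound r.ρ β (2 * S + 1) (1 / 4) Kst 0 :=
      coldFreeEnergyBound_of_strongCoupling r.ρ r.continuous r.mem_unitary hβ0 hβD (2 * S + 1)
    exact coldTraceBound_of_coldFreeEnergyBound r.ρ (by norm_num) hK0 (by omega) hFE
  have hx : ∀ m' : ℕ, 2 * S + 1 ≤ m' + 3 → traceExcess r.ρ β (2 * S + 1) (m' + 2) ≤ ε := by
    intro m' hm'
    have h1 := hT m' (by omega)
    have h2 : A * Real.exp (-(1 / 4 / 2 * ((m' + 2 : ℕ) : ℝ))) ≤ A * Real.exp (-((S : ℝ) / 4)) := by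
      refine mul_le_mul_of_nonneg_left (Real.exp_le_exp.2 ?_) hA0
      have : (2 * S : ℝ) ≤ ((m' + 2 : ℕ) : ℝ) := by exact_mod_cast (show 2 * S ≤ m' + 2 by omega)
      linarith
    exact h1.trans (h2.trans (hS₀.2 S hS))
  -- the thermal budget `8 p² ε = c β₁⁴ ≤ c β⁴`
  have hβ4 : β₁ ^ 4 ≤ β ^ 4 := pow_le_pow_left₀ hβ₁.le hβ1 4
  have hbudget : 8 * (max (r.N : ℝ) 1) ^ 2 * ε ≤ c * β ^ 4 := by
    rw [← hpdef, hε]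
    have : 8 * p ^ 2 * (c * β₁ ^ 4 / (8 * p ^ 2)) = c * β₁ ^ 4 := by field_simp
    rw [this]
    exact mul_le_mul_of_nonneg_left hβ4 hc.le
  have hmain := traceExcess_floor_of_facingCov r hβ0 (2 * S + 1) (by omega) hcovL hx hbudget m
  rw [← hpdef] at hmain
  have he : c / (2 * p ^ 2) * β ^ 4 = c * β ^ 4 / (2 * p ^ 2) := by ring
  rw [he]
  exact hmain

end Summit.QuantumFields.YangMills.Cruxes.IR.VolumeMonotone

end
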